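import Literature.Probability.LatticeModels.ProdBernoulliBK
import Literature.Probability.LatticeModels.ProdBernoulliIndependence
import Literature.Probability.Percolation.ClusterBoundary
import HarnessLib

/-!
# The partially reversed Simon–Lieb inequality (Panis–Schapira 2026, Thm. 1.2) — named fact, PROVED

Topic `Literature/Probability/Percolation`.  The tree proves the (upper) Simon–Lieb / exit
inequality for an arbitrary product Bernoulli measure on the edges of a graph
(`Literature.Probability.Percolation.prodBernoulli_openConn_le_sum_exit`, `LongRangeSimonLieb.lean`,
Duminil-Copin–Tassion 2016, Lemma 1.5).  This file records its exact LOWER companion, new in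
Panis–Schapira 2026, as a named fact (D-0014) in the same generality, and DISCHARGES it
(`panisSchapira_reversedSimonLieb_holds`, below) by the one-page printed proof (pivotal exit edge +
decomposition along the closed-edge cluster + independence over disjoint sets of pairs).

## What is printed (arXiv:2605.30299v1)

* Theorem 1.2 (p. 3), (1.6): "Let `d ≥ 2`. Let `S ⊂ Λ ⊂ ℤ^d` and `p ∈ (0,1)`. For every `o ∈ S`
  and `x ∈ Λ`, `τ_{Λ,p}(o,x) ≥ τ_{S,p}(o,x) + Σ_{u ∈ S, v ∉ S, u ∼ v} E_p[1{o ↔_S u} · p ·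
  τ_{Λ∖C(u;Λ),p}(v,x)]`, where `C(u;Λ)` denotes the cluster of `u` in `Λ`."
* Proof, §2 (pp. 9–10), for finite `Λ`: with `E_uv = {o ↔_S u} ∩ {ω_uv = 1} ∩ {v ↔_Λ x} ∩
  {o ↔ x in ω^{[uv]} ∩ Λ}ᶜ` (`ω^{[uv]}` = `ω` with the edge `uv` closed), (i) `⋃ E_uv ⊆
  {o ↔_Λ x} ∖ {o ↔_S x}`, (ii) `E_uv = {o ↔_S u} ∩ {ω_uv = 1} ∩ {v ↔ x in Λ ∖ C^{[uv]}(u;Λ)}`,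
  (iii) the `E_uv` are pairwise disjoint; hence (2.4) `τ_Λ(o,x) − τ_S(o,x) ≥ Σ P[E_uv]` and
  (2.5) `P[E_uv] = Σ_A 1{o ↔_{A∩S} u} P[C^{[uv]}(u;Λ) = A] · p · τ_{Λ∖A}(v,x)
  = E[1{o ↔_S u} · p · τ_{Λ∖C^{[uv]}(u;Λ)}(v,x)]` (independence over disjoint edge sets).
  "Nothing in the argument uses the lattice" — it is valid for any finite graph with arbitrary
  edge probabilities.

## How it is rendered here (relative to the tree's notions, D-0014)

Finite vertex type `V` (`= Λ`), edge weights `w : Sym2 V → [0,1]`, `μ = prodBernoulli w` on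
`BondConfig V = Set (Sym2 V)` (`IsoradialPercolation.lean`), events `openConn`, `openConnIn`,
clusters `openCluster` (`Percolation.lean`); "`u ∼ v`, weight `p`" ↦ all pairs `u ∈ S`, `v ∉ S`
with weight `w s(u,v)` (absent edges have weight `0` and contribute nothing); "`τ_{Λ∖A}(v,x)`" ↦
`μ.real (openConnIn Aᶜ v x)`; the closed-edge cluster `C^{[uv]}(u;Λ)` ↦
`openCluster (ω ∖ {s(u,v)}) u`.

* `panisSchapira_reversedSimonLieb` — NAMED FACT, the inequality (2.4)–(2.5) with the
  CLOSED-EDGE cluster `C^{[uv]}(u;Λ)` (the middle expression of (2.5), which is what the printed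
  proof establishes):
  `μ(o ↔ x in S) + Σ_{u ∈ S} Σ_{v ∉ S} w_{uv} · ∫ 1{o ↔_S u}(ω) · μ(v ↔ x in (C^{[uv]}_ω(u))ᶜ) dμ(ω)
  ≤ μ(o ↔ x)`.
  RELATION TO (1.6): the displayed (1.6) has the cluster `C(u;Λ)` of `ω` itself in place of
  `C^{[uv]}`; since `v ∈ C(u;Λ)` whenever `ω_uv = 1` and `o ↔_S u` does not depend on `ω_uv`
  (`u ∈ S`, `v ∉ S`), that integrand vanishes on `{ω_uv = 1}` and (1.6) equals the present bound
  with each term multiplied by `1 − w_{uv}` — a consequence of the fact below, weaker by these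
  factors (the last equality of the printed (2.5) silently drops them).  We vendor the stronger
  closed-edge form, which is the one the proof gives and the one consumers (route
  `PercNearOneGluing`, crux `AdditiveGluing`, stub `residualKernel`) ask for; users wanting (1.6)
  verbatim bound `1 − w_{uv} ≤ 1`.
  Users take `(h : panisSchapira_reversedSimonLieb)`.

## References

* R. Panis, B. Schapira, *On reversing the Simon–Lieb inequality in high-dimensional
  percolation*, arXiv:2605.30299 (2026), Thm. 1.2 (p. 3, (1.6)); proof §2 (pp. 9–10),
  (2.3)–(2.5). [PanisSchapira2026]
* H. Duminil-Copin, V. Tassion, Comm. Math. Phys. 343 (2016), Lemma 1.5 (the upper Simon–Lieb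
  inequality in this generality). [DuminilCopinTassionCMP2016]
-/

noncomputable section

namespace Literature.Probability.Percolation

open MeasureTheory LatticeModels
open scoped LatticeModels

/-- **Panis–Schapira 2026, Thm. 1.2 (partially reversed Simon–Lieb inequality), closed-edge
form of (2.4)–(2.5) (named fact).**  For Bernoulli percolation with arbitrary edge weights
`w : Sym2 V → [0,1]` on a finite vertex set `V` (`μ = prodBernoulli w`), a finite `S ⊆ V`,
`o ∈ S` and any `x`:
`μ(o ↔ x in S) + Σ_{u ∈ S} Σ_{v ∉ S} w_{uv} ∫ 1{o ↔ u in S}(ω) · μ(v ↔ x in (C^{[uv]}_ω(u))ᶜ) dμ(ω)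
≤ μ(o ↔ x)`, where `C^{[uv]}_ω(u) = openCluster (ω ∖ {uv}) u` is the cluster of `u` after closing
the edge `uv`.  Printed for `S ⊂ Λ ⊂ ℤ^d` with `τ_{Λ∖A}(v,x) = P(v ↔ x in Λ ∖ A)`; the proof
(events `E_uv`: `o ↔_S u`, `uv` open and pivotal for `o ↔ x`, `v ↔ x` off `C^{[uv]}(u)`;
pairwise disjoint; independence over disjoint edge sets) uses nothing lattice-specific.  The
displayed (1.6) (cluster of `ω` itself) is this bound with each term multiplied by `1 − w_{uv}`,
hence weaker (module docstring).  Users take `(h : panisSchapira_reversedSimonLieb)`.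
[cite: PanisSchapira2026, Thm. 1.2 (p. 3, (1.6)); proof §2, (2.4)–(2.5) (p. 10)] -/
def panisSchapira_reversedSimonLieb : Prop :=
  ∀ (V : Type) [Fintype V] [DecidableEq V] (w : Sym2 V → unitInterval) (S : Finset V) (o x : V),
    o ∈ S →
      (prodBernoulli w).real (openConnIn ↑S o x) +
          ∑ u ∈ S, ∑ v ∈ Sᶜ, (w s(u, v) : ℝ) *
            ∫ ω, (openConnIn (↑S : Set V) o u).indicator (fun _ => (1 : ℝ)) ω *
                (prodBernoulli w).real
                  (openConnIn (openCluster (ω \ {s(u, v)}) u)ᶜ v x) ∂(prodBernoulli w) ≤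
        (prodBernoulli w).real (openConn o x)

/-- Dropping the (non-negative) correction recovers the trivial direction
`μ(o ↔ x in S) ≤ μ(o ↔ x)` — recorded to pin the sign conventions of the fact: GIVEN the fact,
the double sum is at most `μ(o ↔ x) − μ(o ↔ x in S)`. [cite: PanisSchapira2026, Thm. 1.2] -/
theorem sum_exit_correction_le_of_reversedSimonLieb (h : panisSchapira_reversedSimonLieb)
    {V : Type} [Fintype V] [DecidableEq V] (w : Sym2 V → unitInterval) (S : Finset V) {o : V}
    (ho : o ∈ S) (x : V) :
    ∑ u ∈ S, ∑ v ∈ Sᶜ, (w s(u, v) : ℝ) *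
        ∫ ω, (openConnIn (↑S : Set V) o u).indicator (fun _ => (1 : ℝ)) ω *
            (prodBernoulli w).real (openConnIn (openCluster (ω \ {s(u, v)}) u)ᶜ v x)
              ∂(prodBernoulli w) ≤
      (prodBernoulli w).real (openConn o x) - (prodBernoulli w).real (openConnIn ↑S o x) := by
  have := h V w S o x ho
  linarith

/-!
## Discharge — the printed proof (Panis–Schapira 2026, §2, pp. 9–10), step by step

Read: `lit read arxiv:2605.30299`, pp. 9–10.  With `e = uv` (`u ∈ S`, `v ∉ S`),
`ω^{[e]} = ω ∖ {e}` and `C^{[e]}(u) = openCluster (ω ∖ {e}) u`: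

* (2.3)/(ii) `E_uv := {o ↔ u in S} ∩ {e open} ∩ {v ↔ x in (C^{[e]}(u))ᶜ}` (`PanisSchapira.exitEvent`;
  we take the printed form (ii) as the definition, so the printed remark "(ii) holds once we have
  noticed that if `v` or `x` belongs to `A` then `{v ↔ x in Λ ∖ A}` cannot occur" is built in);
* (i) `E_uv ⊆ {o ↔ x} ∖ {o ↔ x in S}` (`PanisSchapira.exitEvent_subset`): on `E_uv` the pair `e` is
  pivotal — in `ω^{[e]}` the cluster of `o` is `C^{[e]}(u) ∌ x`
  (`PanisSchapira.not_reachable_of_mem_exitEvent`), while a path inside `S` never uses `e`;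
* (iii) the `E_uv` are pairwise disjoint (`PanisSchapira.disjoint_exitEvent`): on `E_uv ∩ E_u'v'`
  the open path `o →_S u' → v' → x`, whose last leg avoids `C^{[u'v']}(u') ∋ u`, survives closing
  `e`, contradicting pivotality ("we can close `{u,v}` without destroying the connection between
  `0` and `x`", Figure 2);
* (2.4) `μ(o ↔ x) − μ(o ↔ x in S) ≥ Σ_{u ∈ S, v ∉ S} μ(E_uv)` (finite additivity; pairs of weight `0`
  contribute `0`);
* (2.5) "decomposing according to the value of `C^{[uv]}(u)` … the three events then obtained are
  independent (because they are measurable with respect to disjoint sets of edges)":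
  `μ(E_uv ∩ {C^{[e]}(u) = A}) = μ({o ↔ u in S} ∩ {C^{[e]}(u) = A}) · w_e · μ(v ↔ x in Aᶜ)`
  (`PanisSchapira.real_exitEvent_inter_preimage`: the fibre event reads the pairs touching `A` other
  than `e` — `PanisSchapira.determinedBy_exitFibre`, via the tree's `determinedBy_clusterIs` and the
  observation that on the fibre the path `o →_S u` runs inside `S ∩ A` —, `{e open}` reads `e`, and
  `{v ↔ x in Aᶜ}` reads the pairs inside `Aᶜ`; the tree's
  `prodBernoulli_real_inter_of_determinedBy` twice), and summing over `A`,
  `μ(E_uv) = w_e ∫ 1{o ↔ u in S} μ(v ↔ x in (C^{[e]}_ω(u))ᶜ) dμ(ω)`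
  (`PanisSchapira.real_exitEvent_eq_integral`).

The printed proof treats finite `Λ` first and passes to infinite `Λ` by monotone convergence; the
named fact is the finite-graph statement, which is all that is proved here.
-/

namespace PanisSchapira

variable {V : Type*}

/-! ### Closing one pair -/

/-- An open path inside `T` does not use a pair having an endpoint outside `T`; hence it is still an
open path after that pair is closed. [folklore] -/
theorem pathIn_sdiff_singleton {ω : BondConfig V} {T : Set V} {a b : V} {e : Sym2 V} {z : V}
    (hz : z ∈ e) (hzT : z ∉ T) (h : PathIn (openGraph ω) T a b) :
    PathIn (openGraph (ω \ {e})) T a b := by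
  obtain ⟨ha, h⟩ := h
  refine ⟨ha, ?_⟩
  induction h with
  | refl => exact Relation.ReflTransGen.refl
  | @tail c d hac hcd ih =>
    refine ih.tail ⟨?_, hcd.2⟩
    have hc : c ∈ T := PathIn.right_mem (G := openGraph ω) (A := T) (u := a) ⟨ha, hac⟩
    have hadj := (openGraph_adj ω c d).1 hcd.1
    refine (openGraph_adj _ c d).2 ⟨⟨hadj.1, fun hmem => ?_⟩, hadj.2⟩
    rw [Set.mem_singleton_iff] at hmem
    rw [← hmem, Sym2.mem_iff] at hz
    rcases hz with rfl | rfl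
    · exact hzT hc
    · exact hzT hcd.2

/-- Opening pairs only adds open paths. [folklore] -/
theorem pathIn_of_sdiff {ω : BondConfig V} {F : Set (Sym2 V)} {T : Set V} {a b : V}
    (h : PathIn (openGraph (ω \ F)) T a b) : PathIn (openGraph ω) T a b :=
  h.mono_graph (openGraph_mono Set.sdiff_subset)

/-- `{a ↔ b in T}` does not read a pair with an endpoint outside `T`: it holds after closing such a
pair iff it holds before. [folklore] -/
theorem sdiff_singleton_mem_openConnIn_iff {ω : BondConfig V} {T : Set V} {a b : V} {e : Sym2 V}
    {z : V} (hz : z ∈ e) (hzT : z ∉ T) :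
    ω \ {e} ∈ openConnIn T a b ↔ ω ∈ openConnIn T a b := by
  simp only [DCT16.mem_openConnIn_iff_pathIn]
  exact ⟨pathIn_of_sdiff, pathIn_sdiff_singleton hz hzT⟩

/-- A path inside `T` starting in `K`, where `K` is closed under the adjacency of the graph, is a
path inside `T ∩ K`. [folklore] -/
theorem pathIn_inter_of_closed {G : SimpleGraph V} {T K : Set V} {a b : V} (h : PathIn G T a b)
    (ha : a ∈ K) (hK : ∀ c d, c ∈ K → G.Adj c d → d ∈ K) : PathIn G (T ∩ K) a b := by
  obtain ⟨haT, h⟩ := h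
  refine ⟨⟨haT, ha⟩, ?_⟩
  induction h with
  | refl => exact Relation.ReflTransGen.refl
  | @tail c d hac hcd ih =>
    have hc : c ∈ K := (PathIn.right_mem (G := G) (A := T ∩ K) (u := a) ⟨⟨haT, ha⟩, ih⟩).2
    exact ih.tail ⟨hcd.1, hcd.2, hK c d hc hcd.1⟩

/-! ### The exit events `E_uv` ((2.3), in the printed form (ii)) -/

/-- **Panis–Schapira's event `E_uv`** in the form (ii):
`E_uv = {o ↔ u in S} ∩ {uv open} ∩ {v ↔ x in (C^{[uv]}(u))ᶜ}`, where `C^{[uv]}(u)` is the open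
cluster of `u` after closing the pair `uv`. [cite: PanisSchapira2026, §2 (2.3) and (ii) (pp. 9–10)] -/
def exitEvent (S : Set V) (o x u v : V) : Set (BondConfig V) :=
  openConnIn S o u ∩ {ω | s(u, v) ∈ ω} ∩
    {ω | ω ∈ openConnIn (openCluster (ω \ {s(u, v)}) u)ᶜ v x}

/-- **Pivotality on `E_uv`.** If `v ∉ S` then on `E_uv` the pair `uv` is pivotal for `{o ↔ x}`:
after closing it, `o` lies in `C^{[uv]}(u)` (the path `o →_S u` does not use `uv`) while `x` does
not. [cite: PanisSchapira2026, §2 (2.3) (the factor `{o ↔ x in ω^{[uv]}}ᶜ`)] -/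
theorem not_reachable_of_mem_exitEvent {S : Set V} {o x u v : V} (hv : v ∉ S) {ω : BondConfig V}
    (h : ω ∈ exitEvent S o x u v) : ¬ (openGraph (ω \ {s(u, v)})).Reachable o x := by
  obtain ⟨⟨hou, -⟩, hvx⟩ := h
  intro hox
  obtain ⟨-, hx, -⟩ := hvx
  apply hx
  have hou' : (openGraph (ω \ {s(u, v)})).Reachable o u :=
    openConnIn_subset_openConn S o u
      ((sdiff_singleton_mem_openConnIn_iff (Sym2.mem_mk_right u v) hv).2 hou)
  exact hou'.symm.trans hox

/-- **(i)**: `E_uv ⊆ {o ↔ x} ∖ {o ↔ x in S}` (`v ∉ S`). [cite: PanisSchapira2026, §2 item (i) (p. 9)] -/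
theorem exitEvent_subset {S : Set V} {o x u v : V} (hv : v ∉ S) :
    exitEvent S o x u v ⊆ openConn o x \ openConnIn S o x := by
  intro ω h
  have hnr := not_reachable_of_mem_exitEvent hv h
  obtain ⟨⟨hou, he⟩, hvx⟩ := h
  have hu : u ∈ S := by obtain ⟨-, hu, -⟩ := hou; exact hu
  have huv : u ≠ v := fun h => hv (h ▸ hu)
  refine ⟨?_, fun hox => hnr ?_⟩
  · have h1 : (openGraph ω).Reachable o u := openConnIn_subset_openConn S o u hou
    have h2 : (openGraph ω).Adj u v := (openGraph_adj ω u v).2 ⟨he, huv⟩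
    have h3 : (openGraph ω).Reachable v x := openConnIn_subset_openConn _ v x hvx
    exact h1.trans (h2.reachable.trans h3)
  · exact openConnIn_subset_openConn S o x
      ((sdiff_singleton_mem_openConnIn_iff (Sym2.mem_mk_right u v) hv).2 hox)

/-- **(iii)**: the events `E_uv` (`u ∈ S`, `v ∉ S`) are pairwise disjoint ("if `E_uv ∩ E_u'v'`
occurs, any open path from `o` to `x` has to go through `{u,v}` and `{u',v'}`, and the removal of
one of the two edges should destroy the connection … this situation cannot occur", Figure 2): the
path `o →_S u' → v' → x`, whose last leg runs outside `C^{[u'v']}(u') ∋ u`, avoids the pair `uv`.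
[cite: PanisSchapira2026, §2 item (iii) and Figure 2 (p. 10)] -/
theorem disjoint_exitEvent {S : Set V} {o x u v u' v' : V} (hv : v ∉ S) (hv' : v' ∉ S)
    (hne : (u, v) ≠ (u', v')) : Disjoint (exitEvent S o x u v) (exitEvent S o x u' v') := by
  rw [Set.disjoint_left]
  intro ω h h'
  have hnr := not_reachable_of_mem_exitEvent hv h
  obtain ⟨⟨hou, -⟩, -⟩ := h
  obtain ⟨⟨hou', he'⟩, hvx'⟩ := h'
  have hu' : u' ∈ S := by obtain ⟨-, h, -⟩ := hou'; exact h
  have hu'v' : u' ≠ v' := fun h => hv' (h ▸ hu')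
  -- the two pairs are distinct
  have hee' : s(u', v') ≠ s(u, v) := by
    intro h
    rcases Sym2.eq_iff.1 h with ⟨rfl, rfl⟩ | ⟨rfl, rfl⟩
    · exact hne rfl
    · exact hv hu'
  -- `u ∈ C' := C^{[u'v']}(u')`: both `u` and `u'` are joined to `o` inside `S`, avoiding `u'v'`
  have huC : u ∈ openCluster (ω \ {s(u', v')}) u' := by
    have h1 : (openGraph (ω \ {s(u', v')})).Reachable o u' :=
      openConnIn_subset_openConn S o u'
        ((sdiff_singleton_mem_openConnIn_iff (Sym2.mem_mk_right u' v') hv').2 hou')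
    have h2 : (openGraph (ω \ {s(u', v')})).Reachable o u :=
      openConnIn_subset_openConn S o u
        ((sdiff_singleton_mem_openConnIn_iff (Sym2.mem_mk_right u' v') hv').2 hou)
    exact h1.symm.trans h2
  -- the last leg `v' → x` runs outside `C'`, hence avoids the pair `uv`; so does `o →_S u' ∼ v'`
  have hpath : PathIn (openGraph (ω \ {s(u, v)})) (openCluster (ω \ {s(u', v')}) u')ᶜ v' x :=
    pathIn_sdiff_singleton (Sym2.mem_mk_left u v) (fun h => h huC)
      (DCT16.pathIn_of_mem_openConnIn hvx')
  have h3 : (openGraph (ω \ {s(u, v)})).Reachable v' x :=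
    openConnIn_subset_openConn _ v' x (DCT16.mem_openConnIn_of_pathIn hpath)
  have h1 : (openGraph (ω \ {s(u, v)})).Reachable o u' :=
    openConnIn_subset_openConn S o u'
      ((sdiff_singleton_mem_openConnIn_iff (Sym2.mem_mk_right u v) hv).2 hou')
  have h2 : (openGraph (ω \ {s(u, v)})).Adj u' v' :=
    (openGraph_adj _ u' v').2 ⟨⟨he', by simpa using hee'⟩, hu'v'⟩
  exact hnr (h1.trans (h2.reachable.trans h3))

/-! ### (2.5): decomposition according to the value of `C^{[uv]}(u)` -/

/-- The fibre event `{o ↔ u in S} ∩ {C^{[uv]}(u) = A}`. [cite: PanisSchapira2026, §2 (2.5) (p. 10)] -/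
def exitFibre (S : Set V) (o u v : V) (A : Finset V) : Set (BondConfig V) :=
  openConnIn S o u ∩ (fun ω => ω \ {s(u, v)}) ⁻¹' clusterIs u A

/-- On the fibre `{C^{[uv]}(u) = A}`, `E_uv` is the fibre event intersected with `{uv open}` and
`{v ↔ x in Aᶜ}`. [cite: PanisSchapira2026, §2 (2.5) (p. 10)] -/
theorem exitEvent_inter_preimage (S : Set V) (o x u v : V) (A : Finset V) :
    exitEvent S o x u v ∩ (fun ω => ω \ {s(u, v)}) ⁻¹' clusterIs u A =
      exitFibre S o u v A ∩ ({ω | s(u, v) ∈ ω} ∩ openConnIn (↑A : Set V)ᶜ v x) := by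
  ext ω
  simp only [exitEvent, exitFibre, Set.mem_inter_iff, Set.mem_preimage, Set.mem_setOf_eq,
    mem_clusterIs]
  constructor
  · rintro ⟨⟨⟨hou, he⟩, hvx⟩, hA⟩
    refine ⟨⟨hou, hA⟩, he, ?_⟩
    rw [← hA]; exact hvx
  · rintro ⟨⟨hou, hA⟩, he, hvx⟩
    refine ⟨⟨⟨hou, he⟩, ?_⟩, hA⟩
    rw [hA]; exact hvx

/-- **The fibre event reads the pairs touching `A` other than `uv`** (`v ∉ S`).  On
`{C^{[uv]}(u) = A}` an open path from `o` to `u` inside `S` avoids `uv` and therefore runs inside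
`S ∩ A`, so `{o ↔ u in S}` is read off the pairs inside `S ∩ A` (printed as "`1{o ↔ u in A ∩ S}`"
in (2.5)); `{C^{[uv]}(u) = A}` is read off the pairs touching `A` (the tree's
`determinedBy_clusterIs`), the pair `uv` being closed by fiat. [cite: PanisSchapira2026, §2 (2.5) (p. 10)] -/
theorem determinedBy_exitFibre {S : Set V} {o u v : V} (hv : v ∉ S) (A : Finset V) :
    DeterminedBy (exitFibre S o u v A) (edgesTouching (↑A : Set V) \ {s(u, v)}) := by
  -- the pairs inside `S ∩ A` touch `A` and differ from `uv`
  have hK : (S ∩ (↑A : Set V)).sym2 ⊆ edgesTouching (↑A : Set V) \ {s(u, v)} := by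
    intro f hf
    induction f using Sym2.ind with
    | _ c d =>
      obtain ⟨hc, hd⟩ := Set.mk_mem_sym2_iff.1 hf
      refine ⟨⟨c, Sym2.mem_mk_left c d, hc.2⟩, fun hcd => ?_⟩
      rw [Set.mem_singleton_iff] at hcd
      have hvmem : v ∈ s(c, d) := hcd ▸ Sym2.mem_mk_right u v
      rcases Sym2.mem_iff.1 hvmem with rfl | rfl
      · exact hv hc.1
      · exact hv hd.1
  have key : ∀ ω ω' : BondConfig V,
      ω ∩ (edgesTouching (↑A : Set V) \ {s(u, v)}) = ω' ∩ (edgesTouching (↑A : Set V) \ {s(u, v)}) →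
      ω ∈ exitFibre S o u v A → ω' ∈ exitFibre S o u v A := by
    intro ω ω' hagree hω
    obtain ⟨hou, hA⟩ := hω
    rw [Set.mem_preimage] at hA
    -- the closed-pair configurations agree on every pair touching `A`
    have hagree' : ω \ {s(u, v)} ∩ edgesTouching (↑A : Set V) =
        ω' \ {s(u, v)} ∩ edgesTouching (↑A : Set V) := by
      ext f
      have hf := Set.ext_iff.1 hagree f
      simp only [Set.mem_inter_iff, Set.mem_sdiff, Set.mem_singleton_iff] at hf ⊢
      constructor
      · rintro ⟨⟨hfω, hfe⟩, hfA⟩; exact ⟨⟨(hf.1 ⟨hfω, hfA, hfe⟩).1, hfe⟩, hfA⟩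
      · rintro ⟨⟨hfω, hfe⟩, hfA⟩; exact ⟨⟨(hf.2 ⟨hfω, hfA, hfe⟩).1, hfe⟩, hfA⟩
    have hA' : ω' \ {s(u, v)} ∈ clusterIs u A :=
      ((determinedBy_iff _ _).1 (determinedBy_clusterIs u A) _ _ hagree').1 hA
    refine ⟨?_, hA'⟩
    -- the path `o →_S u` avoids `uv`, hence runs inside `C^{[uv]}(u) = A`
    obtain ⟨-, -, hcl⟩ := mem_clusterIs_iff.1 hA
    have hp : PathIn (openGraph (ω \ {s(u, v)})) S o u :=
      pathIn_sdiff_singleton (Sym2.mem_mk_right u v) hv (DCT16.pathIn_of_mem_openConnIn hou)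
    have hoA : o ∈ (↑A : Set V) := by
      have : o ∈ openCluster (ω \ {s(u, v)}) u :=
        (openConnIn_subset_openConn S o u (DCT16.mem_openConnIn_of_pathIn hp)).symm
      rwa [mem_clusterIs.1 hA] at this
    have hp' : PathIn (openGraph (ω \ {s(u, v)})) (S ∩ ↑A) o u :=
      pathIn_inter_of_closed hp hoA fun c d hc hcd =>
        Finset.mem_coe.2 (hcl c (Finset.mem_coe.1 hc) d ((openGraph_adj _ c d).1 hcd).1
          ((openGraph_adj _ c d).1 hcd).2)
    -- transfer to `ω'` along the pairs inside `S ∩ A`, then enlarge `S ∩ A ⊆ S`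
    have h1 : ω ∈ openConnIn (S ∩ ↑A) o u := DCT16.mem_openConnIn_of_pathIn (pathIn_of_sdiff hp')
    have h2 : ω' ∈ openConnIn (S ∩ ↑A) o u :=
      ((determinedBy_iff _ _).1 (DCT16.determinedBy_openConnIn (S ∩ ↑A) o u hK) ω ω' hagree).1 h1
    exact DCT16.mem_openConnIn_of_pathIn
      ((DCT16.pathIn_of_mem_openConnIn h2).mono Set.inter_subset_left)
  rw [determinedBy_iff]
  intro ω ω' h
  exact ⟨key ω ω' h, key ω' ω h.symm⟩

variable [Fintype V] [DecidableEq V]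

/-- **(2.5), one fibre**: "the three events then obtained are independent (because they are
measurable with respect to disjoint sets of edges)":
`μ(E_uv ∩ {C^{[uv]}(u) = A}) = μ({o ↔ u in S} ∩ {C^{[uv]}(u) = A}) · w_{uv} · μ(v ↔ x in Aᶜ)`, the
three supports being `(pairs touching A) ∖ {uv}`, `{uv}`, and the pairs inside `Aᶜ` (for `u ∈ A`;
for `u ∉ A` the fibre is empty). [cite: PanisSchapira2026, §2 (2.5) (p. 10)] -/
theorem real_exitEvent_inter_preimage (w : Sym2 V → unitInterval) {S : Set V} {o x u v : V}
    (hv : v ∉ S) (A : Finset V) :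
    (prodBernoulli w).real (exitEvent S o x u v ∩ (fun ω => ω \ {s(u, v)}) ⁻¹' clusterIs u A) =
      (prodBernoulli w).real (exitFibre S o u v A) *
        ((w s(u, v) : ℝ) * (prodBernoulli w).real (openConnIn (↑A : Set V)ᶜ v x)) := by
  classical
  by_cases huA : u ∈ A
  swap
  · -- `u ∉ A`: the fibre `{C^{[uv]}(u) = A}` is empty
    have h0 : (fun ω : BondConfig V => ω \ {s(u, v)}) ⁻¹' clusterIs u A = ∅ := by
      rw [clusterIs_eq_empty_of_notMem huA, Set.preimage_empty]
    simp [exitFibre, h0]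
  rw [exitEvent_inter_preimage]
  set T : Set (Sym2 V) := edgesTouching (↑A : Set V) \ {s(u, v)} with hT
  have hF : DeterminedBy (exitFibre S o u v A) T := determinedBy_exitFibre hv A
  -- `{uv open}` reads the pair `uv`, `{v ↔ x in Aᶜ}` reads the pairs inside `Aᶜ`; both are off `T`
  have he_det : DeterminedBy {ω : BondConfig V | s(u, v) ∈ ω} ({s(u, v)} : Set (Sym2 V)) := by
    rw [determinedBy_iff]
    intro ω ω' h
    have := Set.ext_iff.1 h s(u, v)
    simpa using this
  have hAc : ((↑A : Set V)ᶜ).sym2 ⊆ Tᶜ := fun f hf hfT =>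
    Set.disjoint_left.1 (disjoint_edgesTouching_compl_sym2 (↑A : Set V)) hfT.1 hf
  have heT : ({s(u, v)} : Set (Sym2 V)) ⊆ Tᶜ := fun f hf hfT => hfT.2 hf
  have hG : DeterminedBy ({ω : BondConfig V | s(u, v) ∈ ω} ∩ openConnIn (↑A : Set V)ᶜ v x) Tᶜ :=
    (he_det.mono heT).inter (DCT16.determinedBy_openConnIn _ v x hAc)
  -- first independence: the fibre event against the rest
  have hTco : (↑T.toFinset : Set (Sym2 V)) = T := Set.coe_toFinset T
  rw [prodBernoulli_real_inter_of_determinedBy w T.toFinset (by rw [hTco]; exact hF)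
    (by rw [hTco]; exact hG) MeasurableSet.of_discrete MeasurableSet.of_discrete]
  congr 1
  -- second independence: the pair `uv` against the pairs inside `Aᶜ` (`u ∈ A`, so `uv ∉ (Aᶜ)⁽²⁾`)
  have hAc' : ((↑A : Set V)ᶜ).sym2 ⊆ (↑({s(u, v)} : Finset (Sym2 V)) : Set (Sym2 V))ᶜ := by
    intro f hf hfe
    rw [Finset.coe_singleton, Set.mem_singleton_iff] at hfe
    rw [hfe] at hf
    exact (Set.mk_mem_sym2_iff.1 hf).1 (Finset.mem_coe.2 huA)
  rw [prodBernoulli_real_inter_of_determinedBy w {s(u, v)} (by rw [Finset.coe_singleton]; exact he_det)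
    (DCT16.determinedBy_openConnIn _ v x hAc') MeasurableSet.of_discrete MeasurableSet.of_discrete,
    prodBernoulli_real_setOf_mem]

/-- **(2.5)**: `μ(E_uv) = w_{uv} · ∫ 1{o ↔ u in S} · μ(v ↔ x in (C^{[uv]}_ω(u))ᶜ) dμ(ω)` (`v ∉ S`) —
decompose along the (finitely many) values `A` of `C^{[uv]}(u)`, apply the one-fibre factorisation,
and re-sum the simple function `ω ↦ 1{o ↔ u in S}(ω) μ(v ↔ x in (C^{[uv]}_ω(u))ᶜ)`.
[cite: PanisSchapira2026, §2 (2.5) (p. 10)] -/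
theorem real_exitEvent_eq_integral (w : Sym2 V → unitInterval) {S : Set V} {o x u v : V}
    (hv : v ∉ S) :
    (prodBernoulli w).real (exitEvent S o x u v) =
      (w s(u, v) : ℝ) * ∫ ω, (openConnIn S o u).indicator (fun _ => (1 : ℝ)) ω *
        (prodBernoulli w).real (openConnIn (openCluster (ω \ {s(u, v)}) u)ᶜ v x)
          ∂(prodBernoulli w) := by
  classical
  set μ := prodBernoulli w with hμ
  -- the closed-pair cluster of `u`, as a `Finset`
  let cl : BondConfig V → Finset V := fun ω => (Set.toFinite (openCluster (ω \ {s(u, v)}) u)).toFinset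
  have hcl : ∀ ω, (↑(cl ω) : Set V) = openCluster (ω \ {s(u, v)}) u := fun ω =>
    Set.Finite.coe_toFinset _
  have hmem_pre : ∀ ω (A : Finset V),
      ω ∈ (fun ω : BondConfig V => ω \ {s(u, v)}) ⁻¹' clusterIs u A ↔ cl ω = A := by
    intro ω A
    rw [Set.mem_preimage, mem_clusterIs, ← hcl ω, Finset.coe_inj]
  -- (a) `μ(E_uv) = Σ_A μ(E_uv ∩ {C^{[uv]}(u) = A})`
  have hdecomp : μ.real (exitEvent S o x u v) =
      ∑ A : Finset V, μ.real (exitEvent S o x u v ∩ (fun ω => ω \ {s(u, v)}) ⁻¹' clusterIs u A) := by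
    have hU : exitEvent S o x u v = ⋃ A ∈ (Finset.univ : Finset (Finset V)),
        (exitEvent S o x u v ∩ (fun ω => ω \ {s(u, v)}) ⁻¹' clusterIs u A) := by
      ext ω
      simp only [Set.mem_iUnion, Finset.mem_univ, exists_true_left, Set.mem_inter_iff]
      constructor
      · intro h; exact ⟨cl ω, h, (hmem_pre ω (cl ω)).2 rfl⟩
      · rintro ⟨A, h, -⟩; exact h
    have hd : Set.PairwiseDisjoint (↑(Finset.univ : Finset (Finset V)) : Set (Finset V))
        (fun A => exitEvent S o x u v ∩ (fun ω => ω \ {s(u, v)}) ⁻¹' clusterIs u A) :=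
      fun A _ B _ hAB => Disjoint.mono Set.inter_subset_right Set.inter_subset_right
        (Set.disjoint_left.2 fun ω hA hB =>
          hAB (((hmem_pre ω A).1 hA).symm.trans ((hmem_pre ω B).1 hB)))
    calc μ.real (exitEvent S o x u v)
        = μ.real (⋃ A ∈ (Finset.univ : Finset (Finset V)),
            (exitEvent S o x u v ∩ (fun ω => ω \ {s(u, v)}) ⁻¹' clusterIs u A)) := by rw [← hU]
      _ = ∑ A : Finset V, μ.real (exitEvent S o x u v ∩ (fun ω => ω \ {s(u, v)}) ⁻¹' clusterIs u A) :=
          measureReal_biUnion_finset hd fun _ _ => MeasurableSet.of_discrete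
  -- (b) the integrand is the simple function `Σ_A 1_{fibre A} · μ(v ↔ x in Aᶜ)`
  have hptw : ∀ ω, (openConnIn S o u).indicator (fun _ => (1 : ℝ)) ω *
      μ.real (openConnIn (openCluster (ω \ {s(u, v)}) u)ᶜ v x) =
      ∑ A : Finset V, (exitFibre S o u v A).indicator
        (fun _ => μ.real (openConnIn (↑A : Set V)ᶜ v x)) ω := by
    intro ω
    rw [Finset.sum_eq_single (cl ω)]
    · rw [← hcl ω]
      by_cases hou : ω ∈ openConnIn S o u
      · have hfib : ω ∈ exitFibre S o u v (cl ω) := ⟨hou, (hmem_pre ω _).2 rfl⟩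
        rw [Set.indicator_of_mem hou, Set.indicator_of_mem hfib, one_mul]
      · have hfib : ω ∉ exitFibre S o u v (cl ω) := fun h => hou h.1
        rw [Set.indicator_of_notMem hou, Set.indicator_of_notMem hfib, zero_mul]
    · intro A _ hA
      exact Set.indicator_of_notMem (fun h => hA ((hmem_pre ω A).1 h.2).symm) _
    · intro h; exact absurd (Finset.mem_univ _) h
  have hint : ∫ ω, (openConnIn S o u).indicator (fun _ => (1 : ℝ)) ω *
      μ.real (openConnIn (openCluster (ω \ {s(u, v)}) u)ᶜ v x) ∂μ =
      ∑ A : Finset V, μ.real (exitFibre S o u v A) * μ.real (openConnIn (↑A : Set V)ᶜ v x) := by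
    simp_rw [hptw]
    rw [integral_finsetSum _ fun A _ => (integrable_const _).indicator MeasurableSet.of_discrete]
    refine Finset.sum_congr rfl fun A _ => ?_
    rw [integral_indicator_const _ MeasurableSet.of_discrete, smul_eq_mul]
  rw [hdecomp, hint, Finset.mul_sum]
  refine Finset.sum_congr rfl fun A _ => ?_
  rw [real_exitEvent_inter_preimage w hv A]
  ring

end PanisSchapira

/-- **Panis–Schapira 2026, Thm. 1.2 (partially reversed Simon–Lieb inequality) — PROVED**:
discharge of the named fact `panisSchapira_reversedSimonLieb` by the printed proof (§2, pp. 9–10):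
the events `E_uv` are pairwise disjoint subsets of `{o ↔ x} ∖ {o ↔ x in S}` ((i), (iii), (2.4)) and
`μ(E_uv) = w_{uv} ∫ 1{o ↔ u in S} μ(v ↔ x in (C^{[uv]}(u))ᶜ) dμ` ((ii), (2.5)).  The hypothesis
`o ∈ S` of the fact is not needed (for `o ∉ S` every term on the left vanishes).
[cite: PanisSchapira2026, Thm. 1.2 (p. 3); proof §2, (2.3)–(2.5) (pp. 9–10)] -/
theorem panisSchapira_reversedSimonLieb_holds : panisSchapira_reversedSimonLieb := by
  classical
  intro V _ _ w S o x _
  set μ := prodBernoulli w with hμ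
  have hvS : ∀ {v : V}, v ∈ Sᶜ → v ∉ (↑S : Set V) := fun hv h =>
    (Finset.mem_compl.1 hv) (Finset.mem_coe.1 h)
  -- (2.5): each term of the double sum is `μ(E_uv)`
  have hL : ∑ u ∈ S, ∑ v ∈ Sᶜ, (w s(u, v) : ℝ) *
        ∫ ω, (openConnIn (↑S : Set V) o u).indicator (fun _ => (1 : ℝ)) ω *
          μ.real (openConnIn (openCluster (ω \ {s(u, v)}) u)ᶜ v x) ∂μ =
      ∑ u ∈ S, ∑ v ∈ Sᶜ, μ.real (PanisSchapira.exitEvent (↑S : Set V) o x u v) :=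
    Finset.sum_congr rfl fun u _ => Finset.sum_congr rfl fun v hv =>
      (PanisSchapira.real_exitEvent_eq_integral w (S := (↑S : Set V)) (o := o) (x := x) (u := u)
        (hvS hv)).symm
  have hsum : ∑ u ∈ S, ∑ v ∈ Sᶜ, μ.real (PanisSchapira.exitEvent (↑S : Set V) o x u v) =
      ∑ p ∈ S ×ˢ Sᶜ, μ.real (PanisSchapira.exitEvent (↑S : Set V) o x p.1 p.2) :=
    (Finset.sum_product' S Sᶜ fun u v => μ.real (PanisSchapira.exitEvent (↑S : Set V) o x u v)).symm
  -- (iii): pairwise disjoint; (i): inside `{o ↔ x} ∖ {o ↔ x in S}`; hence (2.4)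
  have hdisj : Set.PairwiseDisjoint (↑(S ×ˢ Sᶜ) : Set (V × V))
      (fun p => PanisSchapira.exitEvent (↑S : Set V) o x p.1 p.2) := by
    rintro ⟨u, v⟩ hp ⟨u', v'⟩ hq hpq
    exact PanisSchapira.disjoint_exitEvent (hvS (Finset.mem_product.1 hp).2)
      (hvS (Finset.mem_product.1 hq).2) hpq
  have hsub : (⋃ p ∈ S ×ˢ Sᶜ, PanisSchapira.exitEvent (↑S : Set V) o x p.1 p.2) ⊆
      openConn o x \ openConnIn (↑S) o x := by
    intro ω hω
    simp only [Set.mem_iUnion] at hω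
    obtain ⟨p, hp, hω⟩ := hω
    exact PanisSchapira.exitEvent_subset (hvS (Finset.mem_product.1 hp).2) hω
  have h1 : ∑ p ∈ S ×ˢ Sᶜ, μ.real (PanisSchapira.exitEvent (↑S : Set V) o x p.1 p.2) =
      μ.real (⋃ p ∈ S ×ˢ Sᶜ, PanisSchapira.exitEvent (↑S : Set V) o x p.1 p.2) :=
    (measureReal_biUnion_finset hdisj fun _ _ => MeasurableSet.of_discrete).symm
  have h2 : μ.real (⋃ p ∈ S ×ˢ Sᶜ, PanisSchapira.exitEvent (↑S : Set V) o x p.1 p.2) ≤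
      μ.real (openConn o x) - μ.real (openConnIn (↑S) o x) := by
    rw [← measureReal_sdiff (openConnIn_subset_openConn (↑S) o x) MeasurableSet.of_discrete]
    exact measureReal_mono hsub
  linarith

/-- **Thm. 1.2 in the displayed form (1.6)** — with the cluster `C(u;Λ)` of `ω` ITSELF in place of
the closed-edge cluster `C^{[uv]}(u;Λ)`:
`μ(o ↔ x in S) + Σ_{u ∈ S} Σ_{v ∉ S} w_{uv} ∫ 1{o ↔ u in S}(ω) · μ(v ↔ x in (C_ω(u))ᶜ) dμ(ω) ≤ μ(o ↔ x)`.
It follows from the closed-edge form (`panisSchapira_reversedSimonLieb_holds`) because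
`C^{[uv]}_ω(u) ⊆ C_ω(u)`, so `{v ↔ x in (C_ω(u))ᶜ} ⊆ {v ↔ x in (C^{[uv]}_ω(u))ᶜ}` pointwise (the last
equality of the printed (2.5) is this comparison; the module docstring explains that (1.6) is the
weaker statement). [cite: PanisSchapira2026, Thm. 1.2 (p. 3, (1.6))] -/
theorem panisSchapira_reversedSimonLieb_clusterForm {V : Type} [Fintype V] [DecidableEq V]
    (w : Sym2 V → unitInterval) (S : Finset V) {o : V} (ho : o ∈ S) (x : V) :
    (prodBernoulli w).real (openConnIn ↑S o x) +
        ∑ u ∈ S, ∑ v ∈ Sᶜ, (w s(u, v) : ℝ) *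
          ∫ ω, (openConnIn (↑S : Set V) o u).indicator (fun _ => (1 : ℝ)) ω *
            (prodBernoulli w).real (openConnIn (openCluster ω u)ᶜ v x) ∂(prodBernoulli w) ≤
      (prodBernoulli w).real (openConn o x) := by
  classical
  refine le_trans ?_ (panisSchapira_reversedSimonLieb_holds V w S o x ho)
  refine add_le_add le_rfl (Finset.sum_le_sum fun u _ => Finset.sum_le_sum fun v _ =>
    mul_le_mul_of_nonneg_left ?_ (w s(u, v)).2.1)
  refine integral_mono .of_finite .of_finite fun ω => ?_
  refine mul_le_mul_of_nonneg_left ?_ (Set.indicator_nonneg (fun _ _ => zero_le_one) _)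
  refine measureReal_mono (fun ω' hω' => ?_) (measure_ne_top _ _)
  -- `{v ↔ x in (C_ω(u))ᶜ} ⊆ {v ↔ x in (C^{[uv]}_ω(u))ᶜ}`
  have hsub : (openCluster ω u)ᶜ ⊆ (openCluster (ω \ {s(u, v)}) u)ᶜ :=
    Set.compl_subset_compl.2 fun y (hy : (openGraph (ω \ {s(u, v)})).Reachable u y) =>
      hy.mono (openGraph_mono Set.sdiff_subset)
  exact DCT16.mem_openConnIn_of_pathIn ((DCT16.pathIn_of_mem_openConnIn hω').mono hsub)

end Literature.Probability.Percolation

end
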